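import Literature.MathematicalPhysics.QuantumFieldTheory.Balaban1983to89.B2Eq265From255

/-!
# `Balaban1983to89.B2Eq265PrintedForm` — [Balaban1982Higgs2] Lemma 2.4 (2.65) p.572, value clause, on the (Higgs)₂,₃ carrier of record:
# F12's «under the restrictions (2.55)» form with (i) BOTH (2.67) tails governed by the radii of print's `□₁ ⊆ □₂` (p.572, AS PRINTED:
# «Let us define □₁, □₂ as the sums of large blocks contained in Λ₇^{(k−1)′} and distant from the point y less than 2r(Lᵏε), 4r(Lᵏε)
# respectively, and let us denote □ = Bᵏ(□₂).») — the depth `dist(x, □ᶜ)` of F5–F12 is bounded below by `Lᵏm` from the margin `m` of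
# `x_k` in `□₂` (`eq265_higgs_region_tails`; print's (2.67) p.572, render transcription of record of own `B2Eq267HiggsRegionAsPrinted`:
# «Using Proposition 2.2 and the restrictions (2.55) we get φ^{(k)}(x) = (a_kG_k(□, A^{(k)})Q_k^*(A^{(k)})□₁φ)(x) + O((Lᵏε)^κ), x ∈ Bᵏ(y),
# (2.67)» — its two `e^{−δ₀·dist}`-tails were made explicit by own `B2Eq267HiggsRegion.eq267_higgs_region` as `C₁e^{−dist(x,□ᶜ)/(4K₀Lᵏ)} +
# C₂e^{−ρ/(4K₀)}`) — and (ii) the PRINTED thresholds of (2.55) p.570 «|(∂A)(b)| ≦ c₁p(L^{k−1}ε), |A(x)| ≦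
# (c₁/(μ₀L^{k−1}ε))p(L^{k−1}ε), |(D_{Ā^{(k)}}φ)(b)| ≦ c₁p(L^{k−1}ε), |φ(x)| ≦ (c₁/λ(L^{k−1}ε)^{1/4})p(L^{k−1}ε)» (the typer's `Restr255Printed`;
# `eq265_higgs_region_printed255`)

statement-level skeleton of published theorems with citation tags; proofs where landed; nothing here is a claim
about the Yang–Mills mass gap

PDF held: `paper:balaban1982-cmp86-higgs23-ii` (journal page = PDF page + 554), p. 572 [PDF 18] (Lemma 2.4; the `□₁/□₂` sentence L6–8), p. 570
[PDF 16] ((2.55) L2–5), p. 557 [PDF 3] ((2.2)/(2.5): `p(ε) = b₀(1 + log ε⁻¹)^p`, `λ(ε) = λε^{4−d}`).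

CITATION HEADER (lean-in-tree rule).  T. Bałaban, *(Higgs)₂,₃ quantum fields in a finite volume. II. An upper bound*,
Commun. Math. Phys. **86** (1982) 555–594, doi:10.1007/bf01214890 [Balaban1982Higgs2].  Cell `lit-balaban` (HOME
`run/shared/lean/pub/lit-balaban/`), Phase-2 proof seat **p23** gen 22 (unit `lit-balaban-p23-g22`; free-target protocol G.5-34(d), TAKING #6
line HOME/STATUS.md 2026-08-23); SKELETON row **B2.Lem2.4** (fold owner r02, second reader r14; head `proved p250408 · …` UNCHANGED —
cells-only member, brick F13).  USED BY NAME, never restated: own F12 `B2Eq265From255.eq265_higgs_region_from255`, own F11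
`B2Eq265BoxMargins.mem_underRegion_of_tdist_le`, own F7 `B2Eq265ConstantPart.mem_underRegion_iff_offsets`, r14's `B1Ineq234Concrete.distC`
((I.2.36) `dist(x, Λᶜ)`), the typer's `B2Eq255Concrete.{Restr255, Restr255Printed}`, `B2.pFn` (2.2), `B2LargeField.lambdaEps` (2.5).

THE ARGUMENT.  (i) If `x_k` has coarse margin `m` in the box `□₂ = q + [0,S)ᵈ` then by F11 every fine site within `Lᵏm` of `x` lies in
`□ = Bᵏ(□₂)`, so every site of `□ᶜ` (non-empty: the box is a proper box, `LᵏS < |T_ε|_ν`) is farther than `Lᵏm`, i.e.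
`Lᵏm ≤ dist(x, □ᶜ)` (`le_distC_of_margin`) and `e^{−dist(x,□ᶜ)/(4K₀Lᵏ)} ≤ e^{−m/(4K₀)}`; the first (2.67) tail of F12's bound is replaced
accordingly, all other terms unchanged.  (ii) `Restr255Printed C c₁ b₀ p μ₀ λ ℓ` IS `Restr255 C c₁ (p(ℓ)) (1/(μ₀ℓ)) (1/λ(ℓ)^{1/4})` by
definition, and the three printed thresholds are nonnegative for `b₀ ≥ 0`, `λ > 0`, `0 < ℓ ≤ 1`.

WHAT THIS FILE PROVES (kernel-checked, zero `sorry`; theorems only — NO definition, NO `Prop`-valued fact; axioms standard).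
 §1 `exists_not_mem_underRegion_box` (a proper box has a non-empty complement), **`le_distC_of_margin`** (`Lᵏm ≤ dist(x, Bᵏ(□₂)ᶜ)`).
 §2 **`eq265_higgs_region_tails`** — F12's `eq265_higgs_region_from255` word for word except, in the bound, the first tail
    `C₁·exp(−(1/(4K₀))·(dist(x, □ᶜ)/Lᵏ))` ↦ `C₁·exp(−(1/(4K₀))·m)` (both (2.67) tails now read off the radii: `m ≥ R₁` and `R₁ + 1`).
 §3 **`eq265_higgs_region_printed255`** — §2 under the typer's `Restr255Printed C c₁ b₀ p μ₀ λ ℓ` (binders `{c₁ b₀ p μ₀ λ ℓ}`,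
    `0 ≤ c₁, 0 ≤ b₀, 0 < λ, 0 < ℓ ≤ 1` for `{c₁ pℓ t_A tPhi}`, `0 ≤ c₁, 0 ≤ pℓ, 0 ≤ tPhi`), with `pℓ ↦ p(ℓ) = B2.pFn b₀ p ℓ`,
    `t_A ↦ 1/(μ₀ℓ)`, `tPhi ↦ 1/λ(ℓ)^{1/4} = 1/(B2LargeField.lambdaEps λ ℓ d)^{1/4}` at every occurrence (incl. `δA`'s lower bound).

HONEST SCOPE / DIFFERENCES FROM PRINT (recorded, not hidden; one sentence each).  (a) What remains READ by the user after F13: the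
letter `ℓ ⇐ L^{k−1}ε` of the printed thresholds and `c₁`; the radii `S ⇐ 4r(Lᵏε)`, `m ⇐ 4r(Lᵏε)` (margin of `y`), `R₁ ≤ m ⇐ 2r(Lᵏε)`,
`R_n ⇐ (2.8)`'s collar, `ρ, ρ₁ ⇐ (2.44)`; the regions `Λ₋₁ ⊇ Λ₂ ⊇ Λ₆ ⊇ □₁`, `□₂ ⊆ Λ₂` ((2.8)); and the final SIZE `O(p(Lᵏε))` of the
seven explicit terms via «e^{−δr(Lᵏε)} beats every power» (r14's `rDecayBeatsPowers`) and the printed scalings of `e(Lᵏε)` — NOT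
evaluated here.  (b) Everything else as in F12's HONEST SCOPE (value clause only — (2.66)/(2.77) not here; torus sub-family `Shape P`, odd
`L > 1`, `K₀ ∣ M`; zero external field in (2.54); base point the corner; granularity of `□₁`, `□₂`; constants' provenance — none minted
here).  NOT summit progress.
-/

open scoped BigOperators

noncomputable section

namespace Literature.MathematicalPhysics.QuantumFieldTheory.Balaban1983to89.B2Eq265PrintedForm

open HiggsLattice (ChargeData)
open HiggsAveraging (blockIter toFinest)
open HiggsCovariance (avgQkAdj)
open B2Eq255Concrete (bgScalar256 underRegion mem_underRegion Restr255 Restr255Printed)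
open B2Eq265From255 (eq265_higgs_region_from255)
open B2Eq265BoxMargins (mem_underRegion_of_tdist_le)
open B2Eq265ConstantPart (mem_underRegion_iff_offsets)
open B2Lemma23HiggsLattice (cutMin)
open B1Eq211ZeroFieldTorus (Shape)
open B3MultiscaleFields (toSite ofSite)
open B1Ineq225RegularBox (cellBox)
open B1Ineq234Concrete (distC)
open B1TorusRegionHSizes (IsBigBlockUnion)
open B1TorusCubeCover (half)
open B1TorusCubeLocality26 (rS)

variable {P : HiggsLattice.Params} {k : ℕ}

/-! ## §1 The depth of `x` in `□ = Bᵏ(□₂)` from the margin -/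

section Depth

/-- a proper box `□₂ = q + [0,S)ᵈ` (`LᵏS < |T_ε|_ν`) leaves a fine site outside `□ = Bᵏ(□₂)`: the site at fine offset `LᵏS` from the
corner in direction `0`. [cite: Balaban1982Higgs2, Lemma 2.4 proof p.572 «Let us define □₁, □₂ as the sums of large blocks contained in Λ₇^{(k−1)′} and distant from the point y less than 2r(Lᵏε), 4r(Lᵏε) respectively, and let us denote □ = Bᵏ(□₂). Of course □ ⊂ Bᵏ(Λ₂^{(k−1)′}).»]
[cite: Balaban1982Higgs1, (1.19)–(1.20) p.607] -/
theorem exists_not_mem_underRegion_box (hk : k ≤ P.K) (q : HiggsLattice.Site P k) (Sbox : ℕ) (sq₂ : Finset (HiggsLattice.Site P k))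
    (hsq₂ : ∀ y : HiggsLattice.Site P k, y ∈ sq₂ ↔ ∀ ν : Fin P.d, (y ν - q ν).val < Sbox)
    (hSbox : ∀ μ : Fin P.d, P.L ^ k * Sbox < P.sitesPerDir 0 μ) : ∃ z : HiggsLattice.Site P 0, z ∉ underRegion k sq₂ := by
  set ν₀ : Fin P.d := ⟨0, P.hd⟩
  refine ⟨fun ν => toFinest q ν + (if ν = ν₀ then ((P.L ^ k * Sbox : ℕ) : ZMod (P.sitesPerDir 0 ν)) else 0), ?_⟩
  rw [mem_underRegion_iff_offsets hk q Sbox sq₂ hsq₂]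
  intro h
  have h0 := h ν₀
  simp only [if_true, add_sub_cancel_left, ZMod.val_natCast, Nat.mod_eq_of_lt (hSbox ν₀)] at h0
  exact lt_irrefl _ h0

/-- **`Lᵏm ≤ dist(x, □ᶜ)`**: if `x_k` has margin `m` in the box `□₂` (`m ≤ n_ν(x_k − q)`, `n_ν(x_k − q) + m < S`; `2LᵏS ≤ |T_ε|_ν`,
`LᵏS < |T_ε|_ν`), every fine site outside `□ = Bᵏ(□₂)` is at torus distance `> Lᵏm` from `x` (F11's `mem_underRegion_of_tdist_le`), so
r14's `dist(x, □ᶜ)` ((I.2.36)) is at least `Lᵏm`. [cite: Balaban1982Higgs2, Lemma 2.4 proof p.572 «Let us define □₁, □₂ as the sums of large blocks contained in Λ₇^{(k−1)′} and distant from the point y less than 2r(Lᵏε), 4r(Lᵏε) respectively, and let us denote □ = Bᵏ(□₂). Of course □ ⊂ Bᵏ(Λ₂^{(k−1)′}).»]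
[cite: Balaban1982Higgs1, (2.36) p.612] -/
theorem le_distC_of_margin (hk : k ≤ P.K) (q : HiggsLattice.Site P k) (Sbox : ℕ) (sq₂ : Finset (HiggsLattice.Site P k))
    (hsq₂ : ∀ y : HiggsLattice.Site P k, y ∈ sq₂ ↔ ∀ ν : Fin P.d, (y ν - q ν).val < Sbox)
    (hSbox : ∀ μ : Fin P.d, P.L ^ k * Sbox < P.sitesPerDir 0 μ) (h2S : ∀ μ : Fin P.d, 2 * (P.L ^ k * Sbox) ≤ P.sitesPerDir 0 μ)
    (x : HiggsLattice.Site P 0) (m : ℕ)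
    (hmargin : ∀ ν : Fin P.d, m ≤ ((blockIter k x) ν - q ν).val ∧ ((blockIter k x) ν - q ν).val + m < Sbox) :
    ((P.L ^ k * m : ℕ) : ℝ) ≤ distC (underRegion k sq₂) x := by
  classical
  obtain ⟨z₀, hz₀⟩ := exists_not_mem_underRegion_box hk q Sbox sq₂ hsq₂ hSbox
  have hne : ((underRegion k sq₂)ᶜ).Nonempty := ⟨z₀, Finset.mem_compl.mpr hz₀⟩
  unfold distC
  rw [dif_pos hne, Finset.le_inf'_iff]
  intro z hz
  have hz' : z ∉ underRegion k sq₂ := Finset.mem_compl.mp hz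
  have hlt : ¬ HiggsLattice.Site.tdist x z ≤ P.L ^ k * m := fun hle =>
    hz' (mem_underRegion_of_tdist_le hk q Sbox sq₂ hsq₂ h2S x m (P.L ^ k * m) le_rfl hmargin hle)
  exact_mod_cast (not_le.mp hlt).le

end Depth

/-! ## §2 (2.65) with both (2.67) tails read off the radii -/

section Tails

/-- **LEMMA 2.4 (2.65), VALUE CLAUSE — both (2.67) tails governed by the `□₁`/`□₂` radii.**  TYPED vs PRINTED: F12's
`B2Eq265From255.eq265_higgs_region_from255` word for word except ONE located edit in the bound: the first (2.67) tail
`C₁·exp(−(1/(4K₀))·(dist(x, Bᵏ(□₂)ᶜ)/Lᵏ))` ↦ `C₁·exp(−(1/(4K₀))·m)` (`le_distC_of_margin`; `m ≥ R₁` the margin of `x_k` in `□₂`, print's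
`4r(Lᵏε) ≥ 2r(Lᵏε)`); HONEST SCOPE: both tails are now functions of the radii `m`, `R₁` only; the non-emptiness of `□ᶜ` (proper box)
is used; nothing minted. [cite: Balaban1982Higgs2, Lemma 2.4 (2.65) p.572]
[cite: Balaban1982Higgs2, Lemma 2.4 proof (2.67) p.572 «Using Proposition 2.2 and the restrictions (2.55) we get φ^{(k)}(x) = (a_kG_k(□, A^{(k)})Q_k^*(A^{(k)})□₁φ)(x) + O((Lᵏε)^κ), x ∈ Bᵏ(y)»]
[cite: Balaban1982Higgs2, Lemma 2.4 proof p.572 «Let us define □₁, □₂ as the sums of large blocks contained in Λ₇^{(k−1)′} and distant from the point y less than 2r(Lᵏε), 4r(Lᵏε) respectively, and let us denote □ = Bᵏ(□₂). Of course □ ⊂ Bᵏ(Λ₂^{(k−1)′}).»]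
[cite: Balaban1982Higgs1, (2.36) p.612] -/
theorem eq265_higgs_region_tails (d L : ℕ) (hd : 1 ≤ d) (hL : Odd L ∧ 1 < L) {a : ℝ} (ha : 0 < a) {msq : ℝ} (hmsq : 0 < msq)
    {aV : ℝ} (haV : 0 < aV) {mu0sq : ℝ} (hmu0 : 0 < mu0sq)
    (N : ℕ) (C : ChargeData N) (ε₀ : ℝ) (creg β : ℝ) (hcreg : 0 ≤ creg) (hβ : 0 < β) :
    ∃ δ CV CF : ℝ, 0 < δ ∧ 0 < CV ∧ 0 < CF ∧
    ∃ K₀min : ℕ, ∀ K₀ : ℕ, K₀min ≤ K₀ → ∃ e₁ t : ℝ, 0 < e₁ ∧ 0 < t ∧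
      ∃ C₁ C₂ C₃ D₁ D₂ D₃ D₄ : ℝ, 0 ≤ C₁ ∧ 0 ≤ C₂ ∧ 0 ≤ C₃ ∧ 0 ≤ D₁ ∧ 0 ≤ D₂ ∧ 0 ≤ D₃ ∧ 0 ≤ D₄ ∧
      ∀ (P : HiggsLattice.Params) (_ : Shape P), P.d = d → P.L = L → K₀ ∣ P.M →
      ∀ {k : ℕ}, 1 ≤ k → k ≤ P.K → (∀ μ, 3 * half P k K₀ ≤ P.sitesPerDir 0 μ) → P.mesh k ≤ ε₀ → P.mesh k ≤ 1 →
      ∀ (Λ₂ Λ₆ sq₂ sq₁ : Finset (HiggsLattice.Site P k)) (S : Fin P.d → Finset ℕ) (q : HiggsLattice.Site P k) (Sbox : ℕ),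
        Λ₆ ⊆ Λ₂ → sq₂ ⊆ Λ₂ → sq₁ ⊆ Λ₆ →
        IsBigBlockUnion k K₀ (underRegion k Λ₂) → underRegion k sq₂ = cellBox k K₀ S →
        (∀ μ : Fin P.d, P.L ^ k * Sbox < P.sitesPerDir 0 μ) →
      -- `□₂` IS the box `q + [0,S)ᵈ` of coarse sites, `□ = B^k(□₂)` smaller than half the torus
        (∀ y : HiggsLattice.Site P k, y ∈ sq₂ ↔ ∀ ν : Fin P.d, (y ν - q ν).val < Sbox) →
        (∀ μ : Fin P.d, 2 * (P.L ^ k * Sbox) ≤ P.sitesPerDir 0 μ) →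
      -- `□₁` is the box of coarse sites of radius `R₁` (corner `q₁`); `m ≥ R₁` a coarse margin with `Lᵏm ≥` the depth radius
      ∀ (q₁ : HiggsLattice.Site P k) (R₁ m : ℕ), R₁ ≤ m → 2 * rS P k K₀ + 2 * half P k K₀ * (P.d + 1) + 1 ≤ P.L ^ k * m →
        (∀ y : HiggsLattice.Site P k, y ∈ sq₁ ↔ ∀ ν : Fin P.d, (y ν - q₁ ν).val < 2 * R₁ + 1) →
      -- the region `Λ₋₁` of (2.55); the cutoff `ζ^{(k)}` of (2.44); the cube of radius `R_n ≥ ρ + 1` about every `y ∈ Λ₂` inside `Λ₋₁` ((2.8))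
      ∀ (Λm1 : Finset (HiggsLattice.Site P k))
        (ζ : HiggsLattice.Site P 0 → HiggsLattice.Site P k → ℝ) (ρ ρ₁ : ℝ), 0 ≤ ρ₁ →
        (∀ x y', |ζ x y'| ≤ 1) →
        (∀ x y', ζ x y' ≠ 0 → (HiggsLattice.Site.tdist (blockIter k x) y' : ℝ) ≤ ρ) →
        (∀ x y', (HiggsLattice.Site.tdist (blockIter k x) y' : ℝ) ≤ ρ₁ → ζ x y' = 1) →
        (∀ (x : HiggsLattice.Site P 0) (ν : Fin P.d) (y' : HiggsLattice.Site P k), |ζ (x.shift ν) y' - ζ x y'| ≤ ((P.L : ℝ) ^ k)⁻¹) →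
      ∀ (Rn : ℕ), ρ + 1 ≤ (Rn : ℝ) → (∀ μ : Fin P.d, 2 * (2 * Rn + 1) ≤ P.sitesPerDir k μ) →
        (∀ y ∈ Λ₂, ∀ y' : HiggsLattice.Site P k, HiggsLattice.Site.tdist y y' ≤ Rn → y' ∈ Λm1) →
      -- a charge datum on `ℝ^d`, the step's vector field `A′`, and the letters of (2.55)
      ∀ (C₀ : ChargeData P.d) (A' : HiggsLattice.VecField P k) {c₁ pℓ tA tPhi : ℝ}, 0 ≤ c₁ → 0 ≤ pℓ → 0 ≤ tPhi →
      -- `δA` is at least the (2.60) bound read off (2.55)₁,₂, and small in the two printed scalings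
      ∀ {δA : ℝ}, ((P.L : ℝ) ^ k)⁻¹ * (CV * P.d * (P.mesh k * (c₁ * pℓ)) + CF * Real.exp (-(δ * ρ₁)) * (c₁ * tA * pℓ)) ≤ δA →
          (P.L : ℝ) ^ k * δA * |C.e| ≤ t →
        ∀ {ec : ℝ}, 0 < ec → ec ≤ e₁ → (P.L : ℝ) ^ k * P.mesh k * |C.e| * δA ≤ creg * ec ^ β →
      -- `x ∈ Bᵏ(ȳ)` with `ȳ` the centre of `□₁` and at least `m` inside `□₂` in every direction
      ∀ (x : HiggsLattice.Site P 0),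
        (∀ ν : Fin P.d, m ≤ ((blockIter k x) ν - q ν).val ∧ ((blockIter k x) ν - q ν).val + m < Sbox) →
        (∀ ν : Fin P.d, ((blockIter k x) ν - q₁ ν).val = R₁) →
      -- THE RESTRICTIONS (2.55) on `Λ₋₁` for the fields `A′, φ` of the step and the background `A^{(k)} = a_kζ^{(k)}G_kQ_k^*A′` — all four conjuncts used
      ∀ (φ : HiggsLattice.ScalarField P k N),
        Restr255 C c₁ pℓ tA tPhi k Λm1 A' φ (ofSite (cutMin C₀ mu0sq aV k ζ (toSite A'))) →
        ‖bgScalar256 C msq a k Λ₂ Λ₆ (ofSite (cutMin C₀ mu0sq aV k ζ (toSite A'))) φ x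
            - avgQkAdj C (ofSite (cutMin C₀ mu0sq aV k ζ (toSite A'))) k φ x‖
          ≤ B1.aSeq a P.L k * (c₁ * tPhi * pℓ) *
                (C₁ * Real.exp (-(1 / (4 * K₀) * (m : ℝ)))
                  + C₂ * Real.exp (-(1 / (4 * K₀) * ((R₁ : ℝ) + 1))))
            + (D₁ * P.mesh k ^ 2 *
                (B1.aSeq a P.L k * (P.mesh k)⁻¹ ^ 2 * (|C.e| * (δA * (P.d * ((P.L : ℝ) ^ k * Sbox))) * P.mesh 0 * (P.d * ((P.L : ℝ) ^ k - 1))) * (c₁ * tPhi * pℓ)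
                  + |C.e| * (δA * (P.d * ((P.L : ℝ) ^ k * Sbox))) * (P.d * ((B1.aSeq a P.L k * (P.mesh k)⁻¹ ^ 2 * (c₁ * tPhi * pℓ) * D₄ * P.mesh k
                        + |C.e| * (δA * (P.d * ((P.L : ℝ) ^ k * Sbox))) * (B1.aSeq a P.L k * D₃ * (c₁ * tPhi * pℓ))) + |C.e| * (δA * (P.d * ((P.L : ℝ) ^ k * Sbox))) * (B1.aSeq a P.L k * D₃ * (c₁ * tPhi * pℓ))))
                  + B1.aSeq a P.L k * (P.mesh k)⁻¹ ^ 2 *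
                      ((2 * (|C.e| * (δA * (P.d * ((P.L : ℝ) ^ k * Sbox))) * P.mesh 0 * (P.d * ((P.L : ℝ) ^ k - 1)))
                        + (|C.e| * (δA * (P.d * ((P.L : ℝ) ^ k * Sbox))) * P.mesh 0 * (P.d * ((P.L : ℝ) ^ k - 1))) ^ 2) * (B1.aSeq a P.L k * D₃ * (c₁ * tPhi * pℓ))))
              + D₂ * P.mesh k * (|C.e| * (δA * (P.d * ((P.L : ℝ) ^ k * Sbox))) * (B1.aSeq a P.L k * D₃ * (c₁ * tPhi * pℓ))))
            + B1.aSeq a P.L k * C₃ *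
                (4 * K₀ * ((P.mesh k * (c₁ * pℓ) + P.mesh k * |C.e| * (δA * (P.d * ((P.L : ℝ) ^ k * Sbox))) * (c₁ * tPhi * pℓ)) * P.d)
                  + Real.exp (-(1 / (4 * K₀) * ((R₁ : ℝ) + 1))) * (c₁ * tPhi * pℓ))
            + msq * P.mesh k ^ 2 / (B1.aSeq a P.L k + msq * P.mesh k ^ 2) * (c₁ * tPhi * pℓ)
            + |C.e| * P.mesh 0 * (P.d * ((P.L : ℝ) ^ k - 1)) * (δA * (P.d * ((P.L : ℝ) ^ k * Sbox))) * (c₁ * tPhi * pℓ) := by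
  obtain ⟨δ, CV, CF, hδ, hCV, hCF, K₀min, h⟩ := eq265_higgs_region_from255 d L hd hL ha hmsq haV hmu0 N C ε₀ creg β hcreg hβ
  refine ⟨δ, CV, CF, hδ, hCV, hCF, K₀min, fun K₀ hK₀ => ?_⟩
  obtain ⟨e₁, t, he₁, ht, C₁, C₂, C₃, D₁, D₂, D₃, D₄, hC₁, hC₂, hC₃, hD₁, hD₂, hD₃, hD₄, h⟩ := h K₀ hK₀
  refine ⟨e₁, t, he₁, ht, C₁, C₂, C₃, D₁, D₂, D₃, D₄, hC₁, hC₂, hC₃, hD₁, hD₂, hD₃, hD₄, ?_⟩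
  intro P S hPd hPL hK₀M k hk1 hkK h3 hε h1 Λ₂ Λ₆ sq₂ sq₁ Sfin q Sbox h62 hs2 h16 hΩΛ hbox hSbox hsq₂ h2S q₁ R₁ m hR₁m hRm hsq₁
    Λm1 ζ ρ ρ₁ hρ₁ zeta_abs zeta_supp zeta_one zeta_lip Rn hRn hRn2 hcube C₀ A' c₁ pℓ tA tPhi hc₁ hpℓ htPhi δA h60δ ht' ec hec hle hsmall
    x hmargin hcentre φ h255
  have hmain := h P S hPd hPL hK₀M hk1 hkK h3 hε h1 Λ₂ Λ₆ sq₂ sq₁ Sfin q Sbox h62 hs2 h16 hΩΛ hbox hSbox hsq₂ h2S q₁ R₁ m hR₁m hRm hsq₁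
    Λm1 ζ ρ ρ₁ hρ₁ zeta_abs zeta_supp zeta_one zeta_lip Rn hRn hRn2 hcube C₀ A' hc₁ hpℓ htPhi h60δ ht' hec hle hsmall x hmargin hcentre φ
    h255
  -- the first (2.67) tail through the margin: `Lᵏm ≤ dist(x, □ᶜ)`
  have hLk : (0 : ℝ) < (P.L : ℝ) ^ k := pow_pos (by exact_mod_cast P.hL) k
  have hdist : ((P.L : ℝ) ^ k) * (m : ℝ) ≤ distC (underRegion k sq₂) x := by
    have := le_distC_of_margin hkK q Sbox sq₂ hsq₂ hSbox h2S x m hmargin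
    exact_mod_cast this
  have hexp : Real.exp (-(1 / (4 * K₀) * (distC (underRegion k sq₂) x / (P.L : ℝ) ^ k)))
      ≤ Real.exp (-(1 / (4 * K₀) * (m : ℝ))) := by
    apply Real.exp_le_exp.mpr
    have hK : (0 : ℝ) ≤ 1 / (4 * K₀) := by positivity
    have hm : (m : ℝ) ≤ distC (underRegion k sq₂) x / (P.L : ℝ) ^ k := by
      rw [le_div_iff₀ hLk]; linarith [hdist]
    exact neg_le_neg (mul_le_mul_of_nonneg_left hm hK)
  have hLr : 1 < (P.L : ℝ) := by rw [hPL]; exact_mod_cast hL.2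
  have hak : 0 ≤ B1.aSeq a P.L k := (B1.aSeq_pos ha hLr hk1).le
  have ht0 : 0 ≤ c₁ * tPhi * pℓ := mul_nonneg (mul_nonneg hc₁ htPhi) hpℓ
  have hmono : B1.aSeq a P.L k * (c₁ * tPhi * pℓ) *
        (C₁ * Real.exp (-(1 / (4 * K₀) * (distC (underRegion k sq₂) x / (P.L : ℝ) ^ k)))
          + C₂ * Real.exp (-(1 / (4 * K₀) * ((R₁ : ℝ) + 1))))
      ≤ B1.aSeq a P.L k * (c₁ * tPhi * pℓ) *
        (C₁ * Real.exp (-(1 / (4 * K₀) * (m : ℝ))) + C₂ * Real.exp (-(1 / (4 * K₀) * ((R₁ : ℝ) + 1)))) := by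
    have h1 : C₁ * Real.exp (-(1 / (4 * K₀) * (distC (underRegion k sq₂) x / (P.L : ℝ) ^ k)))
        ≤ C₁ * Real.exp (-(1 / (4 * K₀) * (m : ℝ))) := mul_le_mul_of_nonneg_left hexp hC₁
    exact mul_le_mul_of_nonneg_left (by linarith) (mul_nonneg hak ht0)
  exact hmain.trans (add_le_add (add_le_add (add_le_add (add_le_add hmono le_rfl) le_rfl) le_rfl) le_rfl)

end Tails

/-! ## §3 (2.65) under (2.55) with the printed thresholds -/

section Printed

/-- **LEMMA 2.4 (2.65), VALUE CLAUSE, «UNDER THE RESTRICTIONS (2.55)» WITH THE PRINTED THRESHOLDS** p.570 «|(∂A)(b)| ≦ c₁p(L^{k−1}ε),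
|A(x)| ≦ (c₁/(μ₀L^{k−1}ε))p(L^{k−1}ε), |(D_{Ā^{(k)}}φ)(b)| ≦ c₁p(L^{k−1}ε), |φ(x)| ≦ (c₁/λ(L^{k−1}ε)^{1/4})p(L^{k−1}ε) for x ∈ Λ₋₁^{(k−1)′},
b ⊂ Λ₋₁^{(k−1)′}»: `eq265_higgs_region_tails` with the typer's `Restr255Printed C c₁ b₀ p μ₀ λ ℓ` (`p(ℓ) = b₀(1 + log ℓ⁻¹)^p` = `B2.pFn`
(2.2), `λ(ℓ) = λℓ^{4−d}` = `B2LargeField.lambdaEps` (2.5); `ℓ ↤ L^{k−1}ε` free with `0 < ℓ ≤ 1`, `b₀ ≥ 0`, `λ > 0` for the signs) in place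
of `Restr255 C c₁ pℓ t_A tPhi`, i.e. `pℓ ↦ p(ℓ)`, `t_A ↦ 1/(μ₀ℓ)`, `tPhi ↦ 1/λ(ℓ)^{1/4}` at every occurrence. [cite: Balaban1982Higgs2, Lemma 2.4 (2.65) p.572]
[cite: Balaban1982Higgs2, (2.55) p.570] -/
theorem eq265_higgs_region_printed255 (d L : ℕ) (hd : 1 ≤ d) (hL : Odd L ∧ 1 < L) {a : ℝ} (ha : 0 < a) {msq : ℝ} (hmsq : 0 < msq)
    {aV : ℝ} (haV : 0 < aV) {mu0sq : ℝ} (hmu0 : 0 < mu0sq)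
    (N : ℕ) (C : ChargeData N) (ε₀ : ℝ) (creg β : ℝ) (hcreg : 0 ≤ creg) (hβ : 0 < β) :
    ∃ δ CV CF : ℝ, 0 < δ ∧ 0 < CV ∧ 0 < CF ∧
    ∃ K₀min : ℕ, ∀ K₀ : ℕ, K₀min ≤ K₀ → ∃ e₁ t : ℝ, 0 < e₁ ∧ 0 < t ∧
      ∃ C₁ C₂ C₃ D₁ D₂ D₃ D₄ : ℝ, 0 ≤ C₁ ∧ 0 ≤ C₂ ∧ 0 ≤ C₃ ∧ 0 ≤ D₁ ∧ 0 ≤ D₂ ∧ 0 ≤ D₃ ∧ 0 ≤ D₄ ∧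
      ∀ (P : HiggsLattice.Params) (_ : Shape P), P.d = d → P.L = L → K₀ ∣ P.M →
      ∀ {k : ℕ}, 1 ≤ k → k ≤ P.K → (∀ μ, 3 * half P k K₀ ≤ P.sitesPerDir 0 μ) → P.mesh k ≤ ε₀ → P.mesh k ≤ 1 →
      ∀ (Λ₂ Λ₆ sq₂ sq₁ : Finset (HiggsLattice.Site P k)) (S : Fin P.d → Finset ℕ) (q : HiggsLattice.Site P k) (Sbox : ℕ),
        Λ₆ ⊆ Λ₂ → sq₂ ⊆ Λ₂ → sq₁ ⊆ Λ₆ →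
        IsBigBlockUnion k K₀ (underRegion k Λ₂) → underRegion k sq₂ = cellBox k K₀ S →
        (∀ μ : Fin P.d, P.L ^ k * Sbox < P.sitesPerDir 0 μ) →
      -- `□₂` IS the box `q + [0,S)ᵈ` of coarse sites, `□ = B^k(□₂)` smaller than half the torus
        (∀ y : HiggsLattice.Site P k, y ∈ sq₂ ↔ ∀ ν : Fin P.d, (y ν - q ν).val < Sbox) →
        (∀ μ : Fin P.d, 2 * (P.L ^ k * Sbox) ≤ P.sitesPerDir 0 μ) →
      -- `□₁` is the box of coarse sites of radius `R₁` (corner `q₁`); `m ≥ R₁` a coarse margin with `Lᵏm ≥` the depth radius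
      ∀ (q₁ : HiggsLattice.Site P k) (R₁ m : ℕ), R₁ ≤ m → 2 * rS P k K₀ + 2 * half P k K₀ * (P.d + 1) + 1 ≤ P.L ^ k * m →
        (∀ y : HiggsLattice.Site P k, y ∈ sq₁ ↔ ∀ ν : Fin P.d, (y ν - q₁ ν).val < 2 * R₁ + 1) →
      -- the region `Λ₋₁` of (2.55); the cutoff `ζ^{(k)}` of (2.44); the cube of radius `R_n ≥ ρ + 1` about every `y ∈ Λ₂` inside `Λ₋₁` ((2.8))
      ∀ (Λm1 : Finset (HiggsLattice.Site P k))
        (ζ : HiggsLattice.Site P 0 → HiggsLattice.Site P k → ℝ) (ρ ρ₁ : ℝ), 0 ≤ ρ₁ →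
        (∀ x y', |ζ x y'| ≤ 1) →
        (∀ x y', ζ x y' ≠ 0 → (HiggsLattice.Site.tdist (blockIter k x) y' : ℝ) ≤ ρ) →
        (∀ x y', (HiggsLattice.Site.tdist (blockIter k x) y' : ℝ) ≤ ρ₁ → ζ x y' = 1) →
        (∀ (x : HiggsLattice.Site P 0) (ν : Fin P.d) (y' : HiggsLattice.Site P k), |ζ (x.shift ν) y' - ζ x y'| ≤ ((P.L : ℝ) ^ k)⁻¹) →
      ∀ (Rn : ℕ), ρ + 1 ≤ (Rn : ℝ) → (∀ μ : Fin P.d, 2 * (2 * Rn + 1) ≤ P.sitesPerDir k μ) →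
        (∀ y ∈ Λ₂, ∀ y' : HiggsLattice.Site P k, HiggsLattice.Site.tdist y y' ≤ Rn → y' ∈ Λm1) →
      -- a charge datum on `ℝ^d`, the step's vector field `A′`, and the letters of (2.55)
      ∀ (C₀ : ChargeData P.d) (A' : HiggsLattice.VecField P k) {c₁ b₀ p μ₀ lam ℓ : ℝ}, 0 ≤ c₁ → 0 ≤ b₀ → 0 < lam → 0 < ℓ → ℓ ≤ 1 →
      -- `δA` is at least the (2.60) bound read off (2.55)₁,₂, and small in the two printed scalings
      ∀ {δA : ℝ}, ((P.L : ℝ) ^ k)⁻¹ * (CV * P.d * (P.mesh k * (c₁ * B2.pFn b₀ p ℓ)) + CF * Real.exp (-(δ * ρ₁)) * (c₁ * (1 / (μ₀ * ℓ)) * B2.pFn b₀ p ℓ)) ≤ δA →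
          (P.L : ℝ) ^ k * δA * |C.e| ≤ t →
        ∀ {ec : ℝ}, 0 < ec → ec ≤ e₁ → (P.L : ℝ) ^ k * P.mesh k * |C.e| * δA ≤ creg * ec ^ β →
      -- `x ∈ Bᵏ(ȳ)` with `ȳ` the centre of `□₁` and at least `m` inside `□₂` in every direction
      ∀ (x : HiggsLattice.Site P 0),
        (∀ ν : Fin P.d, m ≤ ((blockIter k x) ν - q ν).val ∧ ((blockIter k x) ν - q ν).val + m < Sbox) →
        (∀ ν : Fin P.d, ((blockIter k x) ν - q₁ ν).val = R₁) →
      -- THE RESTRICTIONS (2.55) on `Λ₋₁` for the fields `A′, φ` of the step and the background `A^{(k)} = a_kζ^{(k)}G_kQ_k^*A′` — all four conjuncts used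
      ∀ (φ : HiggsLattice.ScalarField P k N),
        Restr255Printed C c₁ b₀ p μ₀ lam ℓ k Λm1 A' φ (ofSite (cutMin C₀ mu0sq aV k ζ (toSite A'))) →
        ‖bgScalar256 C msq a k Λ₂ Λ₆ (ofSite (cutMin C₀ mu0sq aV k ζ (toSite A'))) φ x
            - avgQkAdj C (ofSite (cutMin C₀ mu0sq aV k ζ (toSite A'))) k φ x‖
          ≤ B1.aSeq a P.L k * (c₁ * (1 / (B2LargeField.lambdaEps lam ℓ P.d) ^ (1 / 4 : ℝ)) * B2.pFn b₀ p ℓ) *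
                (C₁ * Real.exp (-(1 / (4 * K₀) * (m : ℝ)))
                  + C₂ * Real.exp (-(1 / (4 * K₀) * ((R₁ : ℝ) + 1))))
            + (D₁ * P.mesh k ^ 2 *
                (B1.aSeq a P.L k * (P.mesh k)⁻¹ ^ 2 * (|C.e| * (δA * (P.d * ((P.L : ℝ) ^ k * Sbox))) * P.mesh 0 * (P.d * ((P.L : ℝ) ^ k - 1))) * (c₁ * (1 / (B2LargeField.lambdaEps lam ℓ P.d) ^ (1 / 4 : ℝ)) * B2.pFn b₀ p ℓ)
                  + |C.e| * (δA * (P.d * ((P.L : ℝ) ^ k * Sbox))) * (P.d * ((B1.aSeq a P.L k * (P.mesh k)⁻¹ ^ 2 * (c₁ * (1 / (B2LargeField.lambdaEps lam ℓ P.d) ^ (1 / 4 : ℝ)) * B2.pFn b₀ p ℓ) * D₄ * P.mesh k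
                        + |C.e| * (δA * (P.d * ((P.L : ℝ) ^ k * Sbox))) * (B1.aSeq a P.L k * D₃ * (c₁ * (1 / (B2LargeField.lambdaEps lam ℓ P.d) ^ (1 / 4 : ℝ)) * B2.pFn b₀ p ℓ))) + |C.e| * (δA * (P.d * ((P.L : ℝ) ^ k * Sbox))) * (B1.aSeq a P.L k * D₃ * (c₁ * (1 / (B2LargeField.lambdaEps lam ℓ P.d) ^ (1 / 4 : ℝ)) * B2.pFn b₀ p ℓ))))
                  + B1.aSeq a P.L k * (P.mesh k)⁻¹ ^ 2 *
                      ((2 * (|C.e| * (δA * (P.d * ((P.L : ℝ) ^ k * Sbox))) * P.mesh 0 * (P.d * ((P.L : ℝ) ^ k - 1)))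
                        + (|C.e| * (δA * (P.d * ((P.L : ℝ) ^ k * Sbox))) * P.mesh 0 * (P.d * ((P.L : ℝ) ^ k - 1))) ^ 2) * (B1.aSeq a P.L k * D₃ * (c₁ * (1 / (B2LargeField.lambdaEps lam ℓ P.d) ^ (1 / 4 : ℝ)) * B2.pFn b₀ p ℓ))))
              + D₂ * P.mesh k * (|C.e| * (δA * (P.d * ((P.L : ℝ) ^ k * Sbox))) * (B1.aSeq a P.L k * D₃ * (c₁ * (1 / (B2LargeField.lambdaEps lam ℓ P.d) ^ (1 / 4 : ℝ)) * B2.pFn b₀ p ℓ))))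
            + B1.aSeq a P.L k * C₃ *
                (4 * K₀ * ((P.mesh k * (c₁ * B2.pFn b₀ p ℓ) + P.mesh k * |C.e| * (δA * (P.d * ((P.L : ℝ) ^ k * Sbox))) * (c₁ * (1 / (B2LargeField.lambdaEps lam ℓ P.d) ^ (1 / 4 : ℝ)) * B2.pFn b₀ p ℓ)) * P.d)
                  + Real.exp (-(1 / (4 * K₀) * ((R₁ : ℝ) + 1))) * (c₁ * (1 / (B2LargeField.lambdaEps lam ℓ P.d) ^ (1 / 4 : ℝ)) * B2.pFn b₀ p ℓ))
            + msq * P.mesh k ^ 2 / (B1.aSeq a P.L k + msq * P.mesh k ^ 2) * (c₁ * (1 / (B2LargeField.lambdaEps lam ℓ P.d) ^ (1 / 4 : ℝ)) * B2.pFn b₀ p ℓ)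
            + |C.e| * P.mesh 0 * (P.d * ((P.L : ℝ) ^ k - 1)) * (δA * (P.d * ((P.L : ℝ) ^ k * Sbox))) * (c₁ * (1 / (B2LargeField.lambdaEps lam ℓ P.d) ^ (1 / 4 : ℝ)) * B2.pFn b₀ p ℓ) := by
  obtain ⟨δ, CV, CF, hδ, hCV, hCF, K₀min, h⟩ := eq265_higgs_region_tails d L hd hL ha hmsq haV hmu0 N C ε₀ creg β hcreg hβ
  refine ⟨δ, CV, CF, hδ, hCV, hCF, K₀min, fun K₀ hK₀ => ?_⟩
  obtain ⟨e₁, t, he₁, ht, C₁, C₂, C₃, D₁, D₂, D₃, D₄, hC₁, hC₂, hC₃, hD₁, hD₂, hD₃, hD₄, h⟩ := h K₀ hK₀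
  refine ⟨e₁, t, he₁, ht, C₁, C₂, C₃, D₁, D₂, D₃, D₄, hC₁, hC₂, hC₃, hD₁, hD₂, hD₃, hD₄, ?_⟩
  intro P S hPd hPL hK₀M k hk1 hkK h3 hε h1 Λ₂ Λ₆ sq₂ sq₁ Sfin q Sbox h62 hs2 h16 hΩΛ hbox hSbox hsq₂ h2S q₁ R₁ m hR₁m hRm hsq₁
    Λm1 ζ ρ ρ₁ hρ₁ zeta_abs zeta_supp zeta_one zeta_lip Rn hRn hRn2 hcube C₀ A' c₁ b₀ p μ₀ lam ℓ hc₁ hb₀ hlam hℓ hℓ1 δA h60δ ht' ec hec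
    hle hsmall x hmargin hcentre φ h255
  -- the signs of the printed thresholds
  have hlog : 0 ≤ 1 + Real.log ℓ⁻¹ := by
    have := Real.log_nonneg ((one_le_inv₀ hℓ).mpr hℓ1)
    linarith
  have hpℓ : 0 ≤ B2.pFn b₀ p ℓ := by
    unfold B2.pFn
    exact mul_nonneg hb₀ (Real.rpow_nonneg hlog p)
  have htPhi : 0 ≤ 1 / (B2LargeField.lambdaEps lam ℓ P.d) ^ (1 / 4 : ℝ) :=
    div_nonneg zero_le_one (Real.rpow_nonneg (B2LargeField.lambdaEps_pos hlam hℓ P.d).le _)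
  have h255' : Restr255 C c₁ (B2.pFn b₀ p ℓ) (1 / (μ₀ * ℓ)) (1 / (B2LargeField.lambdaEps lam ℓ P.d) ^ (1 / 4 : ℝ)) k Λm1 A' φ
      (ofSite (cutMin C₀ mu0sq aV k ζ (toSite A'))) := h255
  exact h P S hPd hPL hK₀M hk1 hkK h3 hε h1 Λ₂ Λ₆ sq₂ sq₁ Sfin q Sbox h62 hs2 h16 hΩΛ hbox hSbox hsq₂ h2S q₁ R₁ m hR₁m hRm hsq₁ Λm1 ζ ρ ρ₁
    hρ₁ zeta_abs zeta_supp zeta_one zeta_lip Rn hRn hRn2 hcube C₀ A' hc₁ hpℓ htPhi h60δ ht' hec hle hsmall x hmargin hcentre φ h255'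

end Printed

end Literature.MathematicalPhysics.QuantumFieldTheory.Balaban1983to89.B2Eq265PrintedForm

end
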